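import Mathlib
import HarnessLib
import HarnessLib.Audit

/-!
# ValiantsHypothesis / LacunarySymmetroid — crux `MatrixDescartes` (stmt-ValiantsHypothesis-18050, V1), LINE (A) «product_plus_one»,
# floor `OneChangeFloorK3`: the RAY LAW of the polar curve (weighted-coproduct interlacing)

The `K = 3` company of the floor, `g_j(x) = a_{j0} x^{d₀} + a_{j1} x^{d₁} + a_{j2} x^{d₂}`, is a LINE ARRANGEMENT: with `s = x^{d₁−d₀}`,
`t = x^{d₂−d₀}` every row is the affine form `ℓ_j(s,t) = a_{j0} + a_{j1}s + a_{j2}t`, the product `∏ g_j` is `x^{m d₀}·F(s,t)` with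
`F = ∏ ℓ_j`, and the c-free Euler numerator `eulerNumerator d a 0` is `x^{m d₀}` times the RESTRICTION TO THE ORBIT `t = s^{q/p}`
(`p = d₁−d₀`, `q = d₂−d₀`) of the two-variable polynomial `N = (p·s∂_s + q·t∂_t) F = ∑_j (p a_{j1}s + q a_{j2}t)·∏_{i≠j} ℓ_i`, the
POLAR CURVE `{N = 0}` of the arrangement for the weighted Euler field (idea card `Ideas/arrangement-concavity-dip-count.md`; degree `m`,
Bézout against the orbit = the Descartes count `~ m·q`, the floor asks for `O(m)` orbit crossings).

This file proves the first structural law of that curve, in the only currency it needs (one real variable, no definition): along every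
RAY `t = κ s` (`κ > 0`) of the positive quadrant the rows become `ℓ_j = a_{j0} + e_j s` (`e_j = a_{j1} + κ a_{j2}`) and
`N(s, κs) = s·∑_j c_j ∏_{i≠j} (a_{i0} + e_i s)` (`c_j = p a_{j1} + q κ a_{j2}`); for a normalised no-dip incoherent company (type T5,
`a_{j0} = 1`, `a_{j1}, a_{j2} < 0`, the open core of the floor) all `c_j < 0` and, in the chart `z = 1/s`,
`N(s, κs) = s^m · ∑_j c_j ∏_{i≠j} (z − n_i)` with POSITIVE nodes `n_i = −e_i = |a_{i1}| + κ|a_{i2}|` and weights of ONE sign.  The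
abstract statement is therefore:

* ★ `card_roots_weightedCoproduct` — for weights `w_j > 0` and sorted nodes `n_0 < ⋯ < n_n`, the weighted coproduct
  `Q = ∑_j w_j ∏_{i≠j} (X − n_i)` has EXACTLY `n` distinct real roots, all in `(n_0, n_n)`;
  `exists_root_weightedCoproduct_gap` — one in each gap `(n_k, n_{k+1})`; `eval_weightedCoproduct_node` /
  `eval_weightedCoproduct_node_mul_succ_neg` — `Q(n_k) = w_k ∏_{i≠k}(n_k − n_i)`, consecutive node values have opposite signs;
  `natDegree_weightedCoproduct_le`.

RAY LAW (reading): on every ray of the quadrant the polar curve of a pure-T5 company has exactly ONE point in each radial gap between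
consecutive lines of the arrangement and NONE before the first / after the last line — its real locus in the quadrant is `m − 1` branches,
each a graph over the ray direction, the `k`-th branch trapped between the `k`-th and `(k+1)`-th line along every ray; the orbit
`t = s^{q/p}` is also a graph over the ray direction and visits the `k`-th radial gap exactly on the `k`-th arc between consecutive zeros of
`∏ g_j`, so «zeros of `eulerNumerator` on arc `k`» = «crossings of the orbit with branch `k`».  (Equivalently: the zeros of the Stieltjes sum
`∑_j w_j/(z − n_j)` interlace its poles; equivalently Cauchy interlacing for the compression of `diag(n)` to `(√w)^⊥` — the branch values
are eigenvalues of a compressed AFFINE symmetric pencil `diag(|a_{j1}|) + κ·diag(|a_{j2}|)`, monotone in `κ` but for the rotation of the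
compression direction `√(p|a_{j1}| + qκ|a_{j2}|)`, which is exactly the floor's up-crossing mechanism.)

HONEST FRAMING: a classical interlacing lemma (helper, def-free), the radial normal form of the polar curve; it closes NO stub by name;
`OneChangeFloorK3`, `EulerBoundK3`, `ClassRowK3Linear`, `PPOPolyLaw`, `MatrixDescartes` (stmt-ValiantsHypothesis-18050) stay OPEN;
`VP ≠ VNP` is NOT proved and nothing here bears on it.  No definitions, no named facts, no sorry; Mathlib only.

[folklore] interlacing of the zeros of `∑_j w_j ∏_{i≠j}(z − n_i)` (`w_j > 0`) with the nodes (secular equation / Cauchy interlacing).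
-/

set_option linter.dupNamespace false

namespace Summit.ValiantsHypothesis.ValiantsHypothesis.Theorems.LacunarySymmetroidMatrixDescartes

namespace ProductPlusOne

open Polynomial Finset

/-- **Node values of the weighted coproduct**: at the node `n_k` only the `k`-th term survives,
`Q(n_k) = w_k · ∏_{i ≠ k} (n_k − n_i)`. [folklore] -/
theorem eval_weightedCoproduct_node {n : ℕ} (w e : Fin (n + 1) → ℝ) (k : Fin (n + 1)) :
    (∑ j, C (w j) * ∏ i ∈ univ.erase j, (X - C (e i))).eval (e k)
      = w k * ∏ i ∈ univ.erase k, (e k - e i) := by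
  rw [eval_finsetSum, Finset.sum_eq_single k]
  · rw [eval_mul, eval_C, eval_prod]
    simp only [eval_sub, eval_X, eval_C]
  · intro j _ hjk
    rw [eval_mul, eval_prod]
    have hk : k ∈ univ.erase j := mem_erase.mpr ⟨fun h => hjk h.symm, mem_univ k⟩
    rw [Finset.prod_eq_zero hk (by rw [eval_sub, eval_X, eval_C, sub_self]), mul_zero]
  · intro h
    exact absurd (mem_univ k) h

/-- **Alternation at consecutive nodes**: for positive weights and strictly increasing nodes, the values of the weighted coproduct
at two consecutive nodes have opposite signs (`Q(n_k)·Q(n_{k+1}) < 0`). [folklore] -/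
theorem eval_weightedCoproduct_node_mul_succ_neg {n : ℕ} (w e : Fin (n + 1) → ℝ) (hw : ∀ j, 0 < w j)
    (he : StrictMono e) (k : Fin n) :
    (∑ j, C (w j) * ∏ i ∈ univ.erase j, (X - C (e i))).eval (e k.castSucc)
      * (∑ j, C (w j) * ∏ i ∈ univ.erase j, (X - C (e i))).eval (e k.succ) < 0 := by
  rw [eval_weightedCoproduct_node, eval_weightedCoproduct_node]
  set k₀ : Fin (n + 1) := k.castSucc with hk₀def
  set k₁ : Fin (n + 1) := k.succ with hk₁def
  have h01 : k₀ < k₁ := Fin.castSucc_lt_succ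
  have hne : k₀ ≠ k₁ := h01.ne
  have hk₁ : k₁ ∈ univ.erase k₀ := mem_erase.mpr ⟨hne.symm, mem_univ _⟩
  have hk₀ : k₀ ∈ univ.erase k₁ := mem_erase.mpr ⟨hne, mem_univ _⟩
  have h1 : ∏ i ∈ univ.erase k₀, (e k₀ - e i) = (e k₀ - e k₁) * ∏ i ∈ (univ.erase k₀).erase k₁, (e k₀ - e i) :=
    (Finset.mul_prod_erase (univ.erase k₀) (fun i => e k₀ - e i) hk₁).symm
  have h2 : ∏ i ∈ univ.erase k₁, (e k₁ - e i) = (e k₁ - e k₀) * ∏ i ∈ (univ.erase k₀).erase k₁, (e k₁ - e i) := by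
    rw [Finset.erase_right_comm (a := k₀) (b := k₁)]
    exact (Finset.mul_prod_erase (univ.erase k₁) (fun i => e k₁ - e i) hk₀).symm
  rw [h1, h2]
  have hpos : 0 < ∏ i ∈ (univ.erase k₀).erase k₁, ((e k₀ - e i) * (e k₁ - e i)) := by
    apply Finset.prod_pos
    intro i hi
    have hi₁ : i ≠ k₁ := (mem_erase.mp hi).1
    have hi₀ : i ≠ k₀ := (mem_erase.mp (mem_erase.mp hi).2).1
    rcases lt_or_gt_of_ne hi₀ with hlt | hgt
    · exact mul_pos (sub_pos.mpr (he hlt)) (sub_pos.mpr (he (hlt.trans h01)))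
    · have hgt₁ : k₁ < i := by
        have hv₀ : (k₀ : ℕ) < (i : ℕ) := Fin.lt_def.mp hgt
        have hv₁ : (i : ℕ) ≠ (k₁ : ℕ) := fun h => hi₁ (Fin.ext h)
        have e₀ : (k₀ : ℕ) = (k : ℕ) := by rw [hk₀def, Fin.val_castSucc]
        have e₁ : (k₁ : ℕ) = (k : ℕ) + 1 := by rw [hk₁def, Fin.val_succ]
        rw [Fin.lt_def]
        omega
      exact mul_pos_of_neg_of_neg (sub_neg.mpr (he hgt)) (sub_neg.mpr (he hgt₁))
  have hd : 0 < e k₁ - e k₀ := sub_pos.mpr (he h01)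
  have key : w k₀ * ((e k₀ - e k₁) * ∏ i ∈ (univ.erase k₀).erase k₁, (e k₀ - e i))
      * (w k₁ * ((e k₁ - e k₀) * ∏ i ∈ (univ.erase k₀).erase k₁, (e k₁ - e i)))
      = -(w k₀ * w k₁ * (e k₁ - e k₀) ^ 2 * ∏ i ∈ (univ.erase k₀).erase k₁, ((e k₀ - e i) * (e k₁ - e i))) := by
    rw [Finset.prod_mul_distrib]
    ring
  rw [key]
  have hp : 0 < w k₀ * w k₁ * (e k₁ - e k₀) ^ 2 * ∏ i ∈ (univ.erase k₀).erase k₁, ((e k₀ - e i) * (e k₁ - e i)) :=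
    mul_pos (mul_pos (mul_pos (hw k₀) (hw k₁)) (pow_pos hd 2)) hpos
  linarith

/-- **One root in every gap** (intermediate values): for positive weights and sorted nodes the weighted coproduct vanishes
somewhere strictly between any two consecutive nodes. [folklore] -/
theorem exists_root_weightedCoproduct_gap {n : ℕ} (w e : Fin (n + 1) → ℝ) (hw : ∀ j, 0 < w j) (he : StrictMono e)
    (k : Fin n) :
    ∃ z, e k.castSucc < z ∧ z < e k.succ ∧ (∑ j, C (w j) * ∏ i ∈ univ.erase j, (X - C (e i))).eval z = 0 := by
  set Q := ∑ j, C (w j) * ∏ i ∈ univ.erase j, (X - C (e i)) with hQ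
  have hneg := eval_weightedCoproduct_node_mul_succ_neg w e hw he k
  rw [← hQ] at hneg
  have hab : e k.castSucc ≤ e k.succ := (he (Fin.castSucc_lt_succ)).le
  have hcont : ContinuousOn (fun x => Q.eval x) (Set.Icc (e k.castSucc) (e k.succ)) := Q.continuous.continuousOn
  rcases mul_neg_iff.mp hneg with ⟨h0, h1⟩ | ⟨h0, h1⟩
  · obtain ⟨z, hz, hz0⟩ := intermediate_value_Ioo' hab hcont ⟨h1, h0⟩
    exact ⟨z, hz.1, hz.2, hz0⟩
  · obtain ⟨z, hz, hz0⟩ := intermediate_value_Ioo hab hcont ⟨h0, h1⟩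
    exact ⟨z, hz.1, hz.2, hz0⟩

/-- the weighted coproduct on `n + 1` nodes has degree at most `n`. [folklore] -/
theorem natDegree_weightedCoproduct_le {n : ℕ} (w e : Fin (n + 1) → ℝ) :
    (∑ j, C (w j) * ∏ i ∈ univ.erase j, (X - C (e i))).natDegree ≤ n := by
  apply natDegree_sum_le_of_forall_le
  intro j _
  refine (natDegree_C_mul_le _ _).trans ((natDegree_prod_le _ _).trans ?_)
  simp only [natDegree_X_sub_C, sum_const, smul_eq_mul, mul_one, card_erase_of_mem (mem_univ j), card_univ,
    Fintype.card_fin]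
  omega

/-- ★ **RAY LAW (weighted-coproduct interlacing).** For positive weights `w_j` and strictly increasing nodes `n_0 < ⋯ < n_n`, the
weighted coproduct `Q = ∑_j w_j ∏_{i≠j} (X − n_i)` has exactly `n` distinct real roots, and every real root lies strictly between the
extreme nodes (with `exists_root_weightedCoproduct_gap`: exactly one in each gap).  Reading for the floor: along each ray `t = κs` of the
positive quadrant the polar curve `(p s∂_s + q t∂_t)∏_j ℓ_j = 0` of a pure no-dip-incoherent company meets each radial gap of the line
arrangement `{ℓ_j = 0}` exactly once and misses the two unbounded radial cells. [folklore] -/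
theorem card_roots_weightedCoproduct {n : ℕ} (w e : Fin (n + 1) → ℝ) (hw : ∀ j, 0 < w j) (he : StrictMono e) :
    (∑ j, C (w j) * ∏ i ∈ univ.erase j, (X - C (e i))).roots.toFinset.card = n ∧
      ∀ z ∈ (∑ j, C (w j) * ∏ i ∈ univ.erase j, (X - C (e i))).roots.toFinset, e 0 < z ∧ z < e (Fin.last n) := by
  set Q := ∑ j, C (w j) * ∏ i ∈ univ.erase j, (X - C (e i)) with hQ
  have hval : Q.eval (e 0) = w 0 * ∏ i ∈ univ.erase 0, (e 0 - e i) := by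
    rw [hQ]
    exact eval_weightedCoproduct_node w e 0
  have hQ0 : Q ≠ 0 := by
    intro h
    have hne : Q.eval (e 0) ≠ 0 := by
      rw [hval]
      refine mul_ne_zero (hw 0).ne' (Finset.prod_ne_zero_iff.mpr fun i hi => ?_)
      exact sub_ne_zero.mpr fun h' => (mem_erase.mp hi).1 (he.injective h').symm
    exact hne (by rw [h, eval_zero])
  have hgap : ∀ k : Fin n, ∃ z, e k.castSucc < z ∧ z < e k.succ ∧ Q.eval z = 0 := by
    intro k
    rw [hQ]
    exact exists_root_weightedCoproduct_gap w e hw he k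
  choose z hz using hgap
  have hzmono : StrictMono z := by
    intro k k' hkk'
    have h1 : z k < e k.succ := (hz k).2.1
    have h2 : e k'.castSucc < z k' := (hz k').1
    have h3 : e k.succ ≤ e k'.castSucc := by
      refine he.monotone (Fin.le_def.mpr ?_)
      rw [Fin.val_succ, Fin.val_castSucc]
      exact Nat.succ_le_of_lt (Fin.lt_def.mp hkk')
    linarith
  have hsub : Finset.image z univ ⊆ Q.roots.toFinset := by
    intro x hx
    obtain ⟨k, _, rfl⟩ := mem_image.mp hx
    rw [Multiset.mem_toFinset, mem_roots hQ0, IsRoot.def]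
    exact (hz k).2.2
  have hcard_img : (Finset.image z univ).card = n := by
    rw [card_image_of_injective _ hzmono.injective, card_univ, Fintype.card_fin]
  have hdeg : Q.natDegree ≤ n := by
    rw [hQ]
    exact natDegree_weightedCoproduct_le w e
  have hle : Q.roots.toFinset.card ≤ n :=
    (Multiset.toFinset_card_le _).trans ((card_roots' Q).trans hdeg)
  have heq : Finset.image z univ = Q.roots.toFinset :=
    Finset.eq_of_subset_of_card_le hsub (by rw [hcard_img]; exact hle)
  refine ⟨by rw [← heq, hcard_img], fun x hx => ?_⟩
  rw [← heq] at hx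
  obtain ⟨k, _, rfl⟩ := mem_image.mp hx
  exact ⟨lt_of_le_of_lt (he.monotone (Fin.zero_le _)) (hz k).1,
    lt_of_lt_of_le (hz k).2.1 (he.monotone (Fin.le_last _))⟩

end ProductPlusOne

end Summit.ValiantsHypothesis.ValiantsHypothesis.Theorems.LacunarySymmetroidMatrixDescartes
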